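import Mathlib
import HarnessLib
import Summits.NavierStokesRegularity.NavierStokesRegularity.Theses.IsobarTomography
import Summits.NavierStokesRegularity.NavierStokesRegularity.Theorems.LiouvilleConjectureNS
import Summits.NavierStokesRegularity.NavierStokesRegularity.Theorems.SqueezeCycleSingularZoom
import Summits.NavierStokesRegularity.NavierStokesRegularity.Theorems.SqueezeCycleExtremalBiaxialitySubcriticalOfLiouville
import Summits.NavierStokesRegularity.NavierStokesRegularity.Theorems.IsobarTomographyTubeAlternativeReduction

/-!
# Calibration of the crux `IsobarTomography.TubeAlternative` (stmt-NavierStokesRegularity-11739)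
# against the tree's existing Type-I items

Helper file (theorems only) for the crux D = `TubeAlternative` of route `IsobarTomography` and for
the one open stub of its line `analytic-propagation-local-patch`, the bet
`stub_peakActionDecayOfAntiBlobPeaks` (registered skeleton
`Cruxes/TubeAlternative/Lines/analytic_propagation_local_patch.lean`; reduction bet → crux landed as
`TubeAlternative.AnalyticPropagation.stub_tubeAlternativeOfPeakActionDecay`).

What is certified here, sorry-free:

* **Upper calibration (unconditional arrows between EXISTING items).** Write `TypeIExtends` for
  "every finite-energy (Leray–Hopf) classical solution on `[0,T)` from a rapidly decaying datum with
  the Type-I rate near `T` extends classically past `T`" — verbatim the common consequent of the two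
  PROVED shared items `SqueezeCycle.SingularZoom` / `ClockStretchingLaw.SingularZoom`
  (stmt-10573, `singularZoom_proof`). Then
  `LiouvilleConjectureNS (stmt-10661 ≙ TypeIliouvilleL) ⟹ SqueezeCycle.SqueezeLiouville (stmt-11608)
   ⟹ ClockStretchingLaw.NoSingularTypeIModel (stmt-10569) ⟹ TypeIExtends ⟹ TubeAlternative`,
  and `TypeIExtends` also proves the bet stub's statement (`peakActionDecayOfAntiBlobPeaks_of_typeIExtends`):
  the hypotheses `IsMaximalSmoothSolution ∧ … ∧ IsTypeIBlowup` of D and of the bet are then contradictory.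
* **Lower calibration (inside the route).** Granted the route's own K1 = `BlobRiccatiClosure` and
  K2 = `IsobaricLinesLiouville`, D implies `TypeIExtends` (`typeIExtends_of_tubeAlternative`, the
  tube/blob case split of the route's `closes`); hence granted K1 ∧ K2 the crux is EQUIVALENT to
  `TypeIExtends` (`tubeAlternative_iff_typeIExtends`), i.e. to the exclusion of Type-I blow-up in the
  Clay class — the content the line isolates in its bet.

So the crux sits between two recorded open items: it is implied by `NoSingularTypeIModel`
(stmt-10569, weaker than (L)) and, with K1 ∧ K2, implies Type-I exclusion. References:
Koch–Nadirashvili–Seregin–Šverák, Acta Math. 203 (2009) = arXiv:0709.3599, §1 conjecture (L), §6;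
Albritton–Barker, arXiv:1811.00502, §3 (the zoom behind `SingularZoom`).
-/

-- the problem directory repeats the summit name (D-0017); core's `dupNamespace` linter fires
set_option linter.dupNamespace false

noncomputable section

namespace Summit.NavierStokesRegularity.NavierStokesRegularity.Theorems.TubeAlternative

open Set Filter Topology Function MeasureTheory
open scoped RealInnerProductSpace
open Literature.Analysis Literature.Analysis.FluidPDE
open Summit.NavierStokesRegularity.NavierStokesRegularity.Theses
open Summit.NavierStokesRegularity.NavierStokesRegularity.Theorems

/-! ## 1. Type-I extension proves the crux and the bet (vacuously: the antecedent is void) -/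

/-- **Type-I extension ⟹ `TubeAlternative`.** If every Leray–Hopf classical solution from a rapidly
decaying datum with the Type-I rate near `T` extends classically past `T`, the antecedent of the crux
(`IsMaximalSmoothSolution` = classical ∧ no extension, plus the Type-I rate) is contradictory, so the
crux holds. [folklore] -/
theorem tubeAlternative_of_typeIExtends
    (hext : ∀ (ν T : ℝ), 0 < ν → 0 < T → ∀ (u : ℝ → (EuclideanSpace ℝ (Fin 3)) → (EuclideanSpace ℝ (Fin 3))) (p : ℝ → (EuclideanSpace ℝ (Fin 3)) → ℝ),
      IsClassicalNSSolutionOn (Set.Ico 0 T) ν 0 u p → IsLerayHopfOn T ν 0 (u 0) u →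
      HasRapidSpatialDecay (u 0) → IsTypeIBlowup u T → HasSmoothExtensionPast ν 0 u T) :
    IsobarTomography.TubeAlternative := by
  intro ν T hν hT u p hmax hLH hdec hI _
  exact absurd (hext ν T hν hT u p hmax.1 hLH hdec hI) hmax.2

/-- **Type-I extension ⟹ the bet.** The registered bet stub `stub_peakActionDecayOfAntiBlobPeaks`
of line `analytic-propagation-local-patch` carries the same contradictory antecedent, so it, too,
follows from Type-I extension (stated with the stub's registered signature as conclusion; this is a
CONDITIONAL form and deliberately not named `stub_…`). [folklore] -/
theorem peakActionDecayOfAntiBlobPeaks_of_typeIExtends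
    (hext : ∀ (ν T : ℝ), 0 < ν → 0 < T → ∀ (u : ℝ → (EuclideanSpace ℝ (Fin 3)) → (EuclideanSpace ℝ (Fin 3))) (p : ℝ → (EuclideanSpace ℝ (Fin 3)) → ℝ),
      IsClassicalNSSolutionOn (Set.Ico 0 T) ν 0 u p → IsLerayHopfOn T ν 0 (u 0) u →
      HasRapidSpatialDecay (u 0) → IsTypeIBlowup u T → HasSmoothExtensionPast ν 0 u T) :
    ∀ (ν T : ℝ), 0 < ν → 0 < T → ∀ (u : ℝ → (EuclideanSpace ℝ (Fin 3)) → (EuclideanSpace ℝ (Fin 3))) (p : ℝ → (EuclideanSpace ℝ (Fin 3)) → ℝ),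
    IsMaximalSmoothSolution ν 0 u p T → IsLerayHopfOn T ν 0 (u 0) u →
    HasRapidSpatialDecay (u 0) → IsTypeIBlowup u T →
    (∀ κ θ : ℝ, 0 < κ → 0 < θ → θ < 1 → ∀ t₀ ∈ Set.Ico 0 T, ∃ t ∈ Set.Ico t₀ T, ∃ x : (EuclideanSpace ℝ (Fin 3)),
      0 < ‖curl (u t) x‖ ∧ (∀ y : (EuclideanSpace ℝ (Fin 3)), θ * ‖curl (u t) y‖ ≤ ‖curl (u t) x‖) ∧
      iteratedFDeriv ℝ 2 (p t) x ![curl (u t) x, curl (u t) x] <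
        κ * ‖curl (u t) x‖ ^ 2 * Laplacian.laplacian (p t) x) →
    ∀ η θ : ℝ, 0 < η → 0 < θ → θ < 1 → ∀ t₁ ∈ Set.Ico 0 T, ∃ t ∈ Set.Ico t₁ T, ∃ x : (EuclideanSpace ℝ (Fin 3)),
      0 < ‖curl (u t) x‖ ∧ (∀ y : (EuclideanSpace ℝ (Fin 3)), θ * ‖curl (u t) y‖ ≤ ‖curl (u t) x‖) ∧
      ν⁻¹ ^ 2 * (∫ z in (Set.Ioo (t - 1 / ‖curl (u t) x‖) t) ×ˢ
          Metric.ball x (Real.sqrt (ν / ‖curl (u t) x‖)),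
          |⟪curl (u z.1) z.2, gradient (p z.1) z.2⟫|) < η := by
  intro ν T hν hT u p hmax hLH hdec hI _ _ _ _ _ _ _ _
  exact absurd (hext ν T hν hT u p hmax.1 hLH hdec hI) hmax.2

/-! ## 2. The chain of existing items above the crux -/

/-- **`NoSingularTypeIModel` (stmt-10569) ⟹ `TubeAlternative`**, through the PROVED shared item
`ClockStretchingLaw.SingularZoom` (stmt-10573: no singular Type-I model ⟹ Type-I extension;
Albritton–Barker 2019 §3 forward zoom + KNSS 2009 Lemma 6.1). [cite: AlbrittonBarker2019, §3] -/
theorem tubeAlternative_of_noSingularTypeIModel (hX : ClockStretchingLaw.NoSingularTypeIModel) :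
    IsobarTomography.TubeAlternative :=
  tubeAlternative_of_typeIExtends (clockStretchingLaw_singularZoom_proof hX)

/-- **Liouville on the Type-I model class kills its singular elements**: a field vanishing on
`t < 0` is bounded in every parabolic cylinder at the origin (the step of `SqueezeCycle.closes`
between `SqueezeLiouville` and `SingularZoom`, isolated). [folklore] -/
theorem noSingularTypeIModel_of_squeezeLiouville (hL : SqueezeCycle.SqueezeLiouville) :
    ClockStretchingLaw.NoSingularTypeIModel := by
  intro C v hv hsing
  obtain ⟨t, ht, x, -, hlt⟩ := hsing 1 one_pos 0
  have h0 : v t x = 0 := hL C v hv t ht.2 x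
  rw [h0, norm_zero] at hlt
  exact lt_irrefl _ hlt

/-- **`SqueezeLiouville` (stmt-11608) ⟹ `TubeAlternative`.** [cite: KochNadirashviliSereginSverak2009, §6 Prop. 6.1 (arXiv:0709.3599)] -/
theorem tubeAlternative_of_squeezeLiouville (hL : SqueezeCycle.SqueezeLiouville) :
    IsobarTomography.TubeAlternative :=
  tubeAlternative_of_noSingularTypeIModel (noSingularTypeIModel_of_squeezeLiouville hL)

/-- **The KNSS Liouville conjecture (L) ⟹ `TubeAlternative`.** `LiouvilleConjectureNS`
(canonical conjecture leaf, ≙ item `TypeIliouvilleL` stmt-10661) gives `SqueezeLiouville` by the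
tree's `squeezeLiouville_of_liouvilleConjectureNS`, whence the crux. CONDITIONAL on the open
conjecture; it does not close the item. [cite: KochNadirashviliSereginSverak2009, §1 conjecture (L) (arXiv:0709.3599)] -/
theorem tubeAlternative_of_liouvilleConjectureNS
    (hL : Summit.NavierStokesRegularity.NavierStokesRegularity.LiouvilleConjectureNS) :
    IsobarTomography.TubeAlternative :=
  tubeAlternative_of_squeezeLiouville (squeezeLiouville_of_liouvilleConjectureNS hL)

/-- **(L) ⟹ the bet**, by the same chain. CONDITIONAL on the open conjecture. [cite: KochNadirashviliSereginSverak2009, §1 conjecture (L) (arXiv:0709.3599)] -/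
theorem peakActionDecayOfAntiBlobPeaks_of_liouvilleConjectureNS
    (hL : Summit.NavierStokesRegularity.NavierStokesRegularity.LiouvilleConjectureNS) :
    ∀ (ν T : ℝ), 0 < ν → 0 < T → ∀ (u : ℝ → (EuclideanSpace ℝ (Fin 3)) → (EuclideanSpace ℝ (Fin 3))) (p : ℝ → (EuclideanSpace ℝ (Fin 3)) → ℝ),
    IsMaximalSmoothSolution ν 0 u p T → IsLerayHopfOn T ν 0 (u 0) u →
    HasRapidSpatialDecay (u 0) → IsTypeIBlowup u T →
    (∀ κ θ : ℝ, 0 < κ → 0 < θ → θ < 1 → ∀ t₀ ∈ Set.Ico 0 T, ∃ t ∈ Set.Ico t₀ T, ∃ x : (EuclideanSpace ℝ (Fin 3)),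
      0 < ‖curl (u t) x‖ ∧ (∀ y : (EuclideanSpace ℝ (Fin 3)), θ * ‖curl (u t) y‖ ≤ ‖curl (u t) x‖) ∧
      iteratedFDeriv ℝ 2 (p t) x ![curl (u t) x, curl (u t) x] <
        κ * ‖curl (u t) x‖ ^ 2 * Laplacian.laplacian (p t) x) →
    ∀ η θ : ℝ, 0 < η → 0 < θ → θ < 1 → ∀ t₁ ∈ Set.Ico 0 T, ∃ t ∈ Set.Ico t₁ T, ∃ x : (EuclideanSpace ℝ (Fin 3)),
      0 < ‖curl (u t) x‖ ∧ (∀ y : (EuclideanSpace ℝ (Fin 3)), θ * ‖curl (u t) y‖ ≤ ‖curl (u t) x‖) ∧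
      ν⁻¹ ^ 2 * (∫ z in (Set.Ioo (t - 1 / ‖curl (u t) x‖) t) ×ˢ
          Metric.ball x (Real.sqrt (ν / ‖curl (u t) x‖)),
          |⟪curl (u z.1) z.2, gradient (p z.1) z.2⟫|) < η :=
  peakActionDecayOfAntiBlobPeaks_of_typeIExtends (clockStretchingLaw_singularZoom_proof
    (noSingularTypeIModel_of_squeezeLiouville (squeezeLiouville_of_liouvilleConjectureNS hL)))

/-! ## 3. Inside the route: granted K1 ∧ K2 the crux IS Type-I extension -/

/-- **Granted K1 = `BlobRiccatiClosure` and K2 = `IsobaricLinesLiouville`, the crux gives Type-I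
extension** (the blob/tube case split of the route's `closes`, with the Type-I rate as a hypothesis
instead of `NoTypeII`): a non-extendable solution is maximal; under the blob hypothesis K1 extends it;
otherwise D yields a non-slice-constant isobaric KNSS limit, which K2 makes slice-constant. [folklore] -/
theorem typeIExtends_of_tubeAlternative (hD : IsobarTomography.TubeAlternative)
    (hB : IsobarTomography.BlobRiccatiClosure) (hL : IsobarTomography.IsobaricLinesLiouville) :
    ∀ (ν T : ℝ), 0 < ν → 0 < T → ∀ (u : ℝ → (EuclideanSpace ℝ (Fin 3)) → (EuclideanSpace ℝ (Fin 3))) (p : ℝ → (EuclideanSpace ℝ (Fin 3)) → ℝ),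
      IsClassicalNSSolutionOn (Set.Ico 0 T) ν 0 u p → IsLerayHopfOn T ν 0 (u 0) u →
      HasRapidSpatialDecay (u 0) → IsTypeIBlowup u T → HasSmoothExtensionPast ν 0 u T := by
  intro ν T hν hT u p hcl hLH hdec hI
  by_contra hext
  have hmax : IsMaximalSmoothSolution ν 0 u p T := ⟨hcl, hext⟩
  by_cases hblob : ∃ κ : ℝ, 0 < κ ∧ ∃ Ω : ℝ → ℝ, ∃ t₀ ∈ Set.Ico 0 T, ∀ t ∈ Set.Ico t₀ T,
      (∃ x : (EuclideanSpace ℝ (Fin 3)), Ω t < ‖curl (u t) x‖) ∧ ∀ x : (EuclideanSpace ℝ (Fin 3)), Ω t < ‖curl (u t) x‖ →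
        κ * ‖curl (u t) x‖ ^ 2 * Laplacian.laplacian (p t) x ≤
          iteratedFDeriv ℝ 2 (p t) x ![curl (u t) x, curl (u t) x]
  · exact hext (hB ν T hν hT u p hcl hLH hdec hblob)
  · obtain ⟨v, q, hv, hvq, hcol, hnc⟩ := hD ν T hν hT u p hmax hLH hdec hI hblob
    exact hnc (hL v q hv.isBoundedAncientMildSolution hvq hcol)

/-- **Granted K1 ∧ K2, `TubeAlternative` ⟺ Type-I extension.** So inside the route the crux is
exactly the exclusion of Type-I blow-up for Leray–Hopf classical solutions from rapidly decaying
data; in particular it is implied by `NoSingularTypeIModel` (stmt-10569) and by (L). [folklore] -/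
theorem tubeAlternative_iff_typeIExtends (hB : IsobarTomography.BlobRiccatiClosure)
    (hL : IsobarTomography.IsobaricLinesLiouville) :
    IsobarTomography.TubeAlternative ↔
      ∀ (ν T : ℝ), 0 < ν → 0 < T → ∀ (u : ℝ → (EuclideanSpace ℝ (Fin 3)) → (EuclideanSpace ℝ (Fin 3))) (p : ℝ → (EuclideanSpace ℝ (Fin 3)) → ℝ),
        IsClassicalNSSolutionOn (Set.Ico 0 T) ν 0 u p → IsLerayHopfOn T ν 0 (u 0) u →
        HasRapidSpatialDecay (u 0) → IsTypeIBlowup u T → HasSmoothExtensionPast ν 0 u T :=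
  ⟨fun hD => typeIExtends_of_tubeAlternative hD hB hL, tubeAlternative_of_typeIExtends⟩

/-- **Granted K1 ∧ K2, the bet ⟺ the crux ⟺ Type-I extension**: the bet implies the crux by the
landed reduction `stub_tubeAlternativeOfPeakActionDecay` (p119816), the crux implies Type-I extension
(`typeIExtends_of_tubeAlternative`), and Type-I extension implies the bet
(`peakActionDecayOfAntiBlobPeaks_of_typeIExtends`). Recorded as the implication bet ⟹ Type-I
extension. [folklore] -/
theorem typeIExtends_of_peakActionDecayOfAntiBlobPeaks
    (h5b : ∀ (ν T : ℝ), 0 < ν → 0 < T → ∀ (u : ℝ → (EuclideanSpace ℝ (Fin 3)) → (EuclideanSpace ℝ (Fin 3))) (p : ℝ → (EuclideanSpace ℝ (Fin 3)) → ℝ),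
      IsMaximalSmoothSolution ν 0 u p T → IsLerayHopfOn T ν 0 (u 0) u →
      HasRapidSpatialDecay (u 0) → IsTypeIBlowup u T →
      (∀ κ θ : ℝ, 0 < κ → 0 < θ → θ < 1 → ∀ t₀ ∈ Set.Ico 0 T, ∃ t ∈ Set.Ico t₀ T, ∃ x : (EuclideanSpace ℝ (Fin 3)),
        0 < ‖curl (u t) x‖ ∧ (∀ y : (EuclideanSpace ℝ (Fin 3)), θ * ‖curl (u t) y‖ ≤ ‖curl (u t) x‖) ∧
        iteratedFDeriv ℝ 2 (p t) x ![curl (u t) x, curl (u t) x] <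
          κ * ‖curl (u t) x‖ ^ 2 * Laplacian.laplacian (p t) x) →
      ∀ η θ : ℝ, 0 < η → 0 < θ → θ < 1 → ∀ t₁ ∈ Set.Ico 0 T, ∃ t ∈ Set.Ico t₁ T, ∃ x : (EuclideanSpace ℝ (Fin 3)),
        0 < ‖curl (u t) x‖ ∧ (∀ y : (EuclideanSpace ℝ (Fin 3)), θ * ‖curl (u t) y‖ ≤ ‖curl (u t) x‖) ∧
        ν⁻¹ ^ 2 * (∫ z in (Set.Ioo (t - 1 / ‖curl (u t) x‖) t) ×ˢ
            Metric.ball x (Real.sqrt (ν / ‖curl (u t) x‖)),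
            |⟪curl (u z.1) z.2, gradient (p z.1) z.2⟫|) < η)
    (hB : IsobarTomography.BlobRiccatiClosure) (hL : IsobarTomography.IsobaricLinesLiouville) :
    ∀ (ν T : ℝ), 0 < ν → 0 < T → ∀ (u : ℝ → (EuclideanSpace ℝ (Fin 3)) → (EuclideanSpace ℝ (Fin 3))) (p : ℝ → (EuclideanSpace ℝ (Fin 3)) → ℝ),
      IsClassicalNSSolutionOn (Set.Ico 0 T) ν 0 u p → IsLerayHopfOn T ν 0 (u 0) u →
      HasRapidSpatialDecay (u 0) → IsTypeIBlowup u T → HasSmoothExtensionPast ν 0 u T :=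
  typeIExtends_of_tubeAlternative
    (TubeAlternative.AnalyticPropagation.stub_tubeAlternativeOfPeakActionDecay h5b) hB hL

/-! ## 4. Registered calibration stub (the conjunction, for `--supports`) -/

/-- **Registered tools stub `stub_calibrationTools`** (`ledger workitem stub-add
stmt-NavierStokesRegularity-11739 --name stub_calibrationTools`): the conjunction of the calibration
arrows of this file — (L) ⟹ D, `SqueezeLiouville` ⟹ D, `NoSingularTypeIModel` ⟹ D, and, granted
K1 ∧ K2, D ⟺ Type-I extension. It is a census/calibration stub, not a stub of the line's composition
`TubeAlternative_of`. [folklore] -/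
theorem stub_calibrationTools :
    (Summit.NavierStokesRegularity.NavierStokesRegularity.LiouvilleConjectureNS →
      Summit.NavierStokesRegularity.NavierStokesRegularity.Theses.IsobarTomography.TubeAlternative) ∧
    (Summit.NavierStokesRegularity.NavierStokesRegularity.Theses.SqueezeCycle.SqueezeLiouville →
      Summit.NavierStokesRegularity.NavierStokesRegularity.Theses.IsobarTomography.TubeAlternative) ∧
    (Summit.NavierStokesRegularity.NavierStokesRegularity.Theses.ClockStretchingLaw.NoSingularTypeIModel →
      Summit.NavierStokesRegularity.NavierStokesRegularity.Theses.IsobarTomography.TubeAlternative) ∧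
    (Summit.NavierStokesRegularity.NavierStokesRegularity.Theses.IsobarTomography.BlobRiccatiClosure →
      Summit.NavierStokesRegularity.NavierStokesRegularity.Theses.IsobarTomography.IsobaricLinesLiouville →
      (Summit.NavierStokesRegularity.NavierStokesRegularity.Theses.IsobarTomography.TubeAlternative ↔
        ∀ (ν T : ℝ), 0 < ν → 0 < T →
        ∀ (u : ℝ → EuclideanSpace ℝ (Fin 3) → EuclideanSpace ℝ (Fin 3))
          (p : ℝ → EuclideanSpace ℝ (Fin 3) → ℝ),
        Literature.Analysis.FluidPDE.IsClassicalNSSolutionOn (Set.Ico 0 T) ν 0 u p →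
        Literature.Analysis.FluidPDE.IsLerayHopfOn T ν 0 (u 0) u →
        Literature.Analysis.FluidPDE.HasRapidSpatialDecay (u 0) →
        Literature.Analysis.FluidPDE.IsTypeIBlowup u T →
        Literature.Analysis.FluidPDE.HasSmoothExtensionPast ν 0 u T)) :=
  ⟨tubeAlternative_of_liouvilleConjectureNS, tubeAlternative_of_squeezeLiouville,
    tubeAlternative_of_noSingularTypeIModel, fun hB hL => tubeAlternative_iff_typeIExtends hB hL⟩

/-! ## 5. The tightest existing item: `TypeICertificateLadder.NoTypeIBlowup` (stmt-1217)

The Type-I extension statement written out in §§1–3 is VERBATIM the open crux `NoTypeIBlowup` of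
route `TypeICertificateLadder` (stmt-NavierStokesRegularity-1217; also the unconditional conclusion of
`TypeILiouville`'s (L)-bridge). So the calibration reads: `NoTypeIBlowup ⟹ TubeAlternative`, and
granted K1 ∧ K2, `TubeAlternative ⟺ NoTypeIBlowup`; with `NoTypeII` the route's own target
`NoBlowup` follows (its `closes`, re-derived from the named pieces). -/

/-- **`NoTypeIBlowup` (stmt-1217) ⟹ `TubeAlternative`** (definitional instance of
`tubeAlternative_of_typeIExtends`). [folklore] -/
theorem tubeAlternative_of_noTypeIBlowup (hX : TypeICertificateLadder.NoTypeIBlowup) :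
    IsobarTomography.TubeAlternative :=
  tubeAlternative_of_typeIExtends hX

/-- **Granted K1 ∧ K2, `TubeAlternative` ⟹ `NoTypeIBlowup`** (definitional instance of
`typeIExtends_of_tubeAlternative`). [folklore] -/
theorem noTypeIBlowup_of_tubeAlternative (hD : IsobarTomography.TubeAlternative)
    (hB : IsobarTomography.BlobRiccatiClosure) (hL : IsobarTomography.IsobaricLinesLiouville) :
    TypeICertificateLadder.NoTypeIBlowup :=
  typeIExtends_of_tubeAlternative hD hB hL

/-- **Granted K1 ∧ K2, `TubeAlternative` ⟺ `NoTypeIBlowup` (stmt-1217).** [folklore] -/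
theorem tubeAlternative_iff_noTypeIBlowup (hB : IsobarTomography.BlobRiccatiClosure)
    (hL : IsobarTomography.IsobaricLinesLiouville) :
    IsobarTomography.TubeAlternative ↔ TypeICertificateLadder.NoTypeIBlowup :=
  tubeAlternative_iff_typeIExtends hB hL

/-- **The route's target from its cruxes, through `NoTypeIBlowup`**: K1 ∧ K2 ∧ D give
`NoTypeIBlowup`, and with `NoTypeII` a non-extendable solution would be maximal, hence Type-I, hence
extendable. (The route's `closes` inlined along the calibration.) [folklore] -/
theorem noBlowup_of_cruxes (hB : IsobarTomography.BlobRiccatiClosure)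
    (hL : IsobarTomography.IsobaricLinesLiouville) (hD : IsobarTomography.TubeAlternative)
    (hII : IsobarTomography.NoTypeII) : IsobarTomography.NoBlowup := by
  intro ν T hν hT u p hcl hLH hdec
  by_contra hext
  have hI := hII ν T hν hT u p ⟨hcl, hext⟩ hLH hdec
  exact hext (noTypeIBlowup_of_tubeAlternative hD hB hL ν T hν hT u p hcl hLH hdec hI)

/-- **Registered tools stub `stub_calibrationNoTypeI`** (`ledger workitem stub-add
stmt-NavierStokesRegularity-11739 --name stub_calibrationNoTypeI`): `NoTypeIBlowup ⟹ D`; granted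
K1 ∧ K2, `D ⟺ NoTypeIBlowup`; and K1 → K2 → D → `NoTypeII` → `NoBlowup`. Census/calibration stub,
not a stub of the line's composition. [folklore] -/
theorem stub_calibrationNoTypeI :
    (Summit.NavierStokesRegularity.NavierStokesRegularity.Theses.TypeICertificateLadder.NoTypeIBlowup →
      Summit.NavierStokesRegularity.NavierStokesRegularity.Theses.IsobarTomography.TubeAlternative) ∧
    (Summit.NavierStokesRegularity.NavierStokesRegularity.Theses.IsobarTomography.BlobRiccatiClosure →
      Summit.NavierStokesRegularity.NavierStokesRegularity.Theses.IsobarTomography.IsobaricLinesLiouville →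
      (Summit.NavierStokesRegularity.NavierStokesRegularity.Theses.IsobarTomography.TubeAlternative ↔
        Summit.NavierStokesRegularity.NavierStokesRegularity.Theses.TypeICertificateLadder.NoTypeIBlowup)) ∧
    (Summit.NavierStokesRegularity.NavierStokesRegularity.Theses.IsobarTomography.BlobRiccatiClosure →
      Summit.NavierStokesRegularity.NavierStokesRegularity.Theses.IsobarTomography.IsobaricLinesLiouville →
      Summit.NavierStokesRegularity.NavierStokesRegularity.Theses.IsobarTomography.TubeAlternative →
      Summit.NavierStokesRegularity.NavierStokesRegularity.Theses.IsobarTomography.NoTypeII →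
      Summit.NavierStokesRegularity.NavierStokesRegularity.Theses.IsobarTomography.NoBlowup) :=
  ⟨tubeAlternative_of_noTypeIBlowup, tubeAlternative_iff_noTypeIBlowup,
    fun hB hL hD hII => noBlowup_of_cruxes hB hL hD hII⟩

end Summit.NavierStokesRegularity.NavierStokesRegularity.Theorems.TubeAlternative

end
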